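import Summits.NavierStokesRegularity.FunctionalMining.VorticityMomentProduction
import Summits.NavierStokesRegularity.FunctionalMining.VorticityMomentViscous
import Summits.NavierStokesRegularity.FunctionalMining.SaturatingLawLyapunov
import Literature.Analysis.FluidPDE.TorusNSChessboardTimeAverages
import HarnessLib

/-!
# FunctionalMining — K0 rows `E.q|T_LD|G1` HOLD (∃κ) for EVERY REAL `q > 2`:
# the `Z_q = ∫|ω|^q` saturating law in the kernel (rows `q = 5/2, 3, 10/3, 4, 5, 6`)

Search for candidate a priori estimates; no regularity claim. Cell `pub-nsfunc`, prove seat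
(gen 9). The no-go seat's Theorem G (SIEVELD §3.2) as ONE kernel theorem on
`T³ = UnitAddTorus (Fin 3)`: for every real `q > 2` there is `κ` with

`dZ_q/dt ≤ κ · ν^{−γ} · (2ℰ) · Z_q^{1+1/σ}`, `σ = 2q − 3`, `γ = (3q−3)/(2q−3)`,

along every zero-mean classical solution of unforced Navier–Stokes (`Candidates.SaturatingLaw`).
Assembly: the slice form `Ż_q ≤ qX_q − qνI_q` (`VorticityMomentViscous`, from the tree's `C¹`-weight
balance and the sign of the viscous term at a real exponent), the static bound
`|X_q| ≤ C I_q^{a}(Z Z_q^{1+1/σ})^{1−a}`, `a = γ/(1+γ)` (`VorticityMomentProduction`: pointwise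
Cauchy–Schwarz, Hölder, Calderón–Zygmund at `s = 2q`, the nonlinear Poincaré inequality at the real
parameter `(q−2)/2`, mean-zero Sobolev, outward interpolation), and Young's inequality
`C I^a M^{1−a} ≤ νI + C^{1/(1−a)} ν^{−a/(1−a)} M`. The matrix rows `E.q=5/2, 3, 10/3, 5|T_LD|G1` are
the literal instances below (`q = 4, 6` agree with `VorticityL4SaturatingLaw`,
`VorticityL6SaturatingLaw`); the Lyapunov rows `EK.E.q=5/2|T_M0`, `EK.E.q=3|T_M0` follow by
`SaturatingLaw.antitoneOn_lyapunov`. The constant is existential (mean-zero Sobolev and CZ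
constants); `q = 2` is Lu–Doering (tree `saturatingLaw_enstrophy`).

## Main statements

* `young_rpow` — Young at real weights in the `ν`-split form.
* `vorticityMoment_saturatingLaw` — the law for every real `q > 2`.
* `vorticityMoment_saturatingLaw_five_halves`, `_three`, `_ten_thirds`, `_five` — the matrix rows.
* `vorticityMoment_lyapunov_five_halves`, `_three` — rows `EK.E.q=5/2|T_M0`, `EK.E.q=3|T_M0`.
-/

noncomputable section

open MeasureTheory Finset Set
open scoped InnerProductSpace RealInnerProductSpace ContDiff

namespace Summit.NavierStokesRegularity.FunctionalMining

open Literature.Analysis.FunctionSpaces Literature.Analysis.FunctionSpaces.Torus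
  Literature.Analysis.FluidPDE

namespace VorticityMoment

open VorticityL4 NonlinearPoincare

/-! ## 1. Young's inequality in the `ν`-split form -/

/-- **Young at real weights**: for `0 < a < 1`, `C, I, M ≥ 0`, `ν > 0`:
`C I^a M^{1−a} ≤ ν I + C^{1/(1−a)} ν^{−a/(1−a)} M` (weighted AM–GM with
`x = νI`, `y = C^{1/(1−a)} ν^{−a/(1−a)} M`). [folklore] -/
theorem young_rpow {a C I M ν : ℝ} (ha0 : 0 < a) (ha1 : a < 1) (hC : 0 ≤ C) (hI : 0 ≤ I)
    (hM : 0 ≤ M) (hν : 0 < ν) :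
    C * I ^ a * M ^ (1 - a) ≤ ν * I + C ^ (1 / (1 - a)) * ν ^ (-(a / (1 - a))) * M := by
  have h1a : 0 < 1 - a := by linarith
  have h1a' : 1 - a ≠ 0 := h1a.ne'
  obtain ⟨x, hx⟩ : ∃ x : ℝ, x = ν * I := ⟨_, rfl⟩
  obtain ⟨y, hy⟩ : ∃ y : ℝ, y = C ^ (1 / (1 - a)) * ν ^ (-(a / (1 - a))) * M := ⟨_, rfl⟩
  have hx0 : 0 ≤ x := by rw [hx]; positivity
  have hνp : 0 ≤ ν ^ (-(a / (1 - a))) := Real.rpow_nonneg hν.le _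
  have hCp : 0 ≤ C ^ (1 / (1 - a)) := Real.rpow_nonneg hC _
  have hy0 : 0 ≤ y := by rw [hy]; positivity
  have hAG : x ^ a * y ^ (1 - a) ≤ a * x + (1 - a) * y :=
    Real.geom_mean_le_arith_mean2_weighted ha0.le h1a.le hx0 hy0 (by ring)
  have hkey : x ^ a * y ^ (1 - a) = C * I ^ a * M ^ (1 - a) := by
    rw [hx, hy, Real.mul_rpow hν.le hI, Real.mul_rpow (mul_nonneg hCp hνp) hM,
      Real.mul_rpow hCp hνp, ← Real.rpow_mul hC, ← Real.rpow_mul hν.le,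
      show 1 / (1 - a) * (1 - a) = 1 by field_simp, Real.rpow_one,
      show -(a / (1 - a)) * (1 - a) = -a by field_simp]
    have hνν : ν ^ a * ν ^ (-a) = 1 := by
      rw [← Real.rpow_add hν, add_neg_cancel, Real.rpow_zero]
    calc ν ^ a * I ^ a * (C * ν ^ (-a) * M ^ (1 - a))
        = (ν ^ a * ν ^ (-a)) * (C * I ^ a * M ^ (1 - a)) := by ring
      _ = C * I ^ a * M ^ (1 - a) := by rw [hνν, one_mul]
  rw [← hkey, ← hx, ← hy]
  calc x ^ a * y ^ (1 - a) ≤ a * x + (1 - a) * y := hAG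
    _ ≤ x + y := by nlinarith

/-! ## 2. The saturating law for real `q` -/

/-- `Z_q` in the matrix's spelling: `torusVorticityMoment q v = ∫ (|ω|²)^{q/2}`. [folklore] -/
theorem torusVorticityMoment_eq (q : ℝ) (v : UnitAddTorus (Fin 3) → EuclideanSpace ℝ (Fin 3)) :
    torusVorticityMoment q v = ∫ x, torusVorticitySqAt v x ^ (q / 2) := rfl

/-- On `T³`, `Z_q = ∫‖curl v‖^q`. [folklore] -/
theorem torusVorticityMoment_eq_integral_norm_curl (q : ℝ)
    (v : UnitAddTorus (Fin 3) → EuclideanSpace ℝ (Fin 3)) :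
    torusVorticityMoment q v = ∫ x, ‖BDSV.curl v x‖ ^ q := by
  rw [torusVorticityMoment_eq]
  refine integral_congr_ae (ae_of_all _ fun x => ?_)
  show torusVorticitySqAt v x ^ (q / 2) = ‖BDSV.curl v x‖ ^ q
  rw [vorticitySqAt_rpow_eq]; congr 1; ring

/-- **K0 rows `E.q|T_LD|G1` HOLD (∃κ) for every real `q > 2`, in the kernel, on
`T³ = UnitAddTorus (Fin 3)`.** There is a constant `κ` such that along every zero-mean classical
solution of the unforced Navier–Stokes equations on `T³` (`ν > 0`), at every time of the window,
`s ↦ Z_q(u(s)) = ∫|ω|^q` is differentiable within the window and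
`dZ_q/dt ≤ κ · ν^{−(3q−3)/(2q−3)} · (2ℰ) · Z_q^{1+1/(2q−3)}` — the cell's saturating law `T_LD` with
`σ = 2q − 3`, `γ = (3q−3)/(2q−3)` (`Candidates.SaturatingLaw`, `torusVorticityMoment q`), the
exponents of SIEVELD §3.2 (Theorem G). Existential constant (mean-zero Sobolev and Calderón–Zygmund
constants); an a priori inequality, small-data closing only.
[ours; SIEVELD §3.2 with tree inputs, cf. Gibbon2010 App. A] -/
theorem vorticityMoment_saturatingLaw {q : ℝ} (hq : 2 < q) :
    ∃ κ : ℝ, SaturatingLaw (d := Fin 3) (torusVorticityMoment q) (2 * q - 3)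
      ((3 * q - 3) / (2 * q - 3)) κ := by
  obtain ⟨C₆, hC₆0, hC₆⟩ :=
    Torus.exists_integral_norm_pow_six_le_gradNormSq_cube (d := Fin 3) (by simp)
  obtain ⟨K, hK0, hK⟩ := exists_cz_rpow (q := q) (by linarith)
  -- the exponent `e = a = γ/(1+γ)` and the static constant
  obtain ⟨e, he⟩ : ∃ e : ℝ, e = (3 * q - 3) / (5 * q - 6) := ⟨_, rfl⟩
  obtain ⟨CT, hCT⟩ : ∃ C : ℝ, C = 32 * (C₆ * (1 + (q - 2) / 2) ^ 6 +
      (6 * (1 + ((3 : ℝ) ^ (1 + (q - 2) / 2)) ^ 2) * (1 + (q - 2) / 2) ^ 2 *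
        (Fintype.card (Fin 3) : ℝ) ^ 3) ^ 3) := ⟨_, rfl⟩
  obtain ⟨CX, hCX⟩ : ∃ C : ℝ, C = Real.sqrt 2 * K ^ (1 / q) * CT ^ (e / 3) := ⟨_, rfl⟩
  have h56 : 0 < 5 * q - 6 := by linarith
  have h23 : 0 < 2 * q - 3 := by linarith
  have he0 : 0 < e := by rw [he]; exact div_pos (by linarith) h56
  have he1 : e < 1 := by rw [he, div_lt_one h56]; linarith
  have h1e : 1 - e = (2 * q - 3) / (5 * q - 6) := by
    rw [he, one_sub_div h56.ne']; congr 1; ring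
  have hγ : e / (1 - e) = (3 * q - 3) / (2 * q - 3) := by
    rw [h1e, he, div_div_div_cancel_right₀ h56.ne']
  have hCT0 : 0 ≤ CT := by rw [hCT]; positivity
  have hCX0 : 0 ≤ CX := by rw [hCX]; positivity
  refine ⟨q * CX ^ (1 / (1 - e)), ?_⟩
  intro _ ν hν a b hab u p hsol hmean t ht
  have hut : IsSmooth (u t) := hsol.smooth_velocity.isSmooth_slice ht
  have hdiv : IsDivFree (u t) := hsol.divFree t ht
  have hF : (fun s => torusVorticityMoment q (u s)) =
      fun s => ∫ x, torusVorticitySqAt (u s) x ^ (q / 2) := rfl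
  obtain ⟨hdiff, hle⟩ := derivWithin_Zq_le hab hν.le hsol hq ht
  refine ⟨by rw [hF]; exact hdiff, ?_⟩
  rw [hF]
  show _ ≤ q * CX ^ (1 / (1 - e)) * ν ^ (-((3 * q - 3) / (2 * q - 3))) *
      (2 * torusEnstrophy (u t)) * (torusVorticityMoment q (u t)) ^ (1 + (2 * q - 3)⁻¹)
  -- opaque names for the slice quantities
  obtain ⟨X, hX⟩ : ∃ X : ℝ, X = ∫ x, torusVorticitySqAt (u t) x ^ (q / 2 - 1) *
      torusStretchingDensity (u t) x := ⟨_, rfl⟩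
  obtain ⟨I, hI⟩ : ∃ I : ℝ, I = ∫ x, ‖BDSV.curl (u t) x‖ ^ (q - 2) *
      ∑ k, ‖partialDeriv k (BDSV.curl (u t)) x‖ ^ 2 := ⟨_, rfl⟩
  obtain ⟨Z, hZ⟩ : ∃ Z : ℝ, Z = ∫ x, ‖BDSV.curl (u t) x‖ ^ (2 : ℝ) := ⟨_, rfl⟩
  obtain ⟨F, hFq⟩ : ∃ F : ℝ, F = ∫ x, ‖BDSV.curl (u t) x‖ ^ q := ⟨_, rfl⟩
  obtain ⟨M, hM⟩ : ∃ M : ℝ, M = Z * F ^ (1 + (2 * q - 3)⁻¹) := ⟨_, rfl⟩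
  rw [← hX, ← hI] at hle
  have hI0 : 0 ≤ I := by
    rw [hI]; exact integral_nonneg fun x => mul_nonneg (Real.rpow_nonneg (norm_nonneg _) _)
      (Finset.sum_nonneg fun k _ => sq_nonneg _)
  have hZ0 : 0 ≤ Z := by rw [hZ]; exact integral_nonneg fun x => Real.rpow_nonneg (norm_nonneg _) _
  have hF0 : 0 ≤ F := by rw [hFq]; exact integral_nonneg fun x => Real.rpow_nonneg (norm_nonneg _) _
  have hM0 : 0 ≤ M := by rw [hM]; exact mul_nonneg hZ0 (Real.rpow_nonneg hF0 _)
  -- the static bound `|X| ≤ CX I^e M^{1-e}`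
  have hstat : |X| ≤ CX * I ^ e * M ^ (1 - e) := by
    have h := production_rpow_bound hC₆0 hK0 hq hC₆ hK hut hdiv
    rw [← hX, ← hI, ← hZ, ← hFq, ← hCT, ← he, ← hM] at h
    have hsplit : (CT * I ^ 3) ^ (e / 3) = CT ^ (e / 3) * I ^ e := by
      rw [Real.mul_rpow hCT0 (pow_nonneg hI0 3), ← Real.rpow_natCast I 3, ← Real.rpow_mul hI0]
      congr 2
      push_cast
      ring
    rw [hsplit] at h
    calc |X| ≤ Real.sqrt 2 * K ^ (1 / q) * (CT ^ (e / 3) * I ^ e) * M ^ (1 - e) := h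
      _ = CX * I ^ e * M ^ (1 - e) := by rw [hCX]; ring
  -- Young
  have hY := young_rpow he0 he1 hCX0 hI0 hM0 hν
  -- the budget in closed form
  have hbudget : q * CX ^ (1 / (1 - e)) * ν ^ (-((3 * q - 3) / (2 * q - 3))) *
      (2 * torusEnstrophy (u t)) * (torusVorticityMoment q (u t)) ^ (1 + (2 * q - 3)⁻¹) =
      q * (CX ^ (1 / (1 - e)) * ν ^ (-(e / (1 - e))) * M) := by
    have e1 : 2 * torusEnstrophy (u t) = Z := by
      rw [hZ, ← integral_torusVorticitySqAt_eq_two_mul_torusEnstrophy hut hdiv]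
      exact integral_congr_ae (ae_of_all _ fun x => by
        show torusVorticitySqAt (u t) x = ‖BDSV.curl (u t) x‖ ^ (2 : ℝ)
        rw [Real.rpow_two, norm_curl_sq])
    have e2 : torusVorticityMoment q (u t) = F := by
      rw [torusVorticityMoment_eq_integral_norm_curl, hFq]
    rw [e1, e2, hγ, hM]
    ring
  rw [hbudget]
  have hXle : X ≤ |X| := le_abs_self X
  have hq0 : 0 ≤ q := by linarith
  have h1 : q * X - q * ν * I ≤ q * (CX ^ (1 / (1 - e)) * ν ^ (-(e / (1 - e))) * M) := by
    have := mul_le_mul_of_nonneg_left (hXle.trans (hstat.trans hY)) hq0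
    linarith
  exact hle.trans h1

/-! ## 3. The matrix rows -/

/-- **Row `E.q=5/2|T_LD|G1` (kernel):** `∃ κ, SaturatingLaw (torusVorticityMoment (5/2)) 2 (9/4) κ`
on `T³`. [ours] -/
theorem vorticityMoment_saturatingLaw_five_halves :
    ∃ κ : ℝ, SaturatingLaw (d := Fin 3) (torusVorticityMoment (5 / 2)) 2 (9 / 4) κ := by
  obtain ⟨κ, hκ⟩ := vorticityMoment_saturatingLaw (q := 5 / 2) (by norm_num)
  have e1 : (2 : ℝ) * (5 / 2) - 3 = 2 := by norm_num
  have e2 : ((3 : ℝ) * (5 / 2) - 3) / (2 * (5 / 2) - 3) = 9 / 4 := by norm_num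
  rw [e2, e1] at hκ
  exact ⟨κ, hκ⟩

/-- **Row `E.q=3|T_LD|G1` (kernel):** `∃ κ, SaturatingLaw (torusVorticityMoment 3) 3 2 κ` on `T³`.
[ours] -/
theorem vorticityMoment_saturatingLaw_three :
    ∃ κ : ℝ, SaturatingLaw (d := Fin 3) (torusVorticityMoment 3) 3 2 κ := by
  obtain ⟨κ, hκ⟩ := vorticityMoment_saturatingLaw (q := 3) (by norm_num)
  have e1 : (2 : ℝ) * 3 - 3 = 3 := by norm_num
  have e2 : ((3 : ℝ) * 3 - 3) / (2 * 3 - 3) = 2 := by norm_num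
  rw [e2, e1] at hκ
  exact ⟨κ, hκ⟩

/-- **Row `E.q=10/3|T_LD|G1` (kernel):**
`∃ κ, SaturatingLaw (torusVorticityMoment (10/3)) (11/3) (21/11) κ` on `T³`. [ours] -/
theorem vorticityMoment_saturatingLaw_ten_thirds :
    ∃ κ : ℝ, SaturatingLaw (d := Fin 3) (torusVorticityMoment (10 / 3)) (11 / 3) (21 / 11) κ := by
  obtain ⟨κ, hκ⟩ := vorticityMoment_saturatingLaw (q := 10 / 3) (by norm_num)
  have e1 : (2 : ℝ) * (10 / 3) - 3 = 11 / 3 := by norm_num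
  have e2 : ((3 : ℝ) * (10 / 3) - 3) / (2 * (10 / 3) - 3) = 21 / 11 := by norm_num
  rw [e2, e1] at hκ
  exact ⟨κ, hκ⟩

/-- **Row `E.q=5|T_LD|G1` (kernel):** `∃ κ, SaturatingLaw (torusVorticityMoment 5) 7 (12/7) κ` on
`T³`. [ours] -/
theorem vorticityMoment_saturatingLaw_five :
    ∃ κ : ℝ, SaturatingLaw (d := Fin 3) (torusVorticityMoment 5) 7 (12 / 7) κ := by
  obtain ⟨κ, hκ⟩ := vorticityMoment_saturatingLaw (q := 5) (by norm_num)
  have e1 : (2 : ℝ) * 5 - 3 = 7 := by norm_num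
  have e2 : ((3 : ℝ) * 5 - 3) / (2 * 5 - 3) = 12 / 7 := by norm_num
  rw [e2, e1] at hκ
  exact ⟨κ, hκ⟩

/-! ## 4. The Lyapunov rows `EK.E.q=5/2|T_M0`, `EK.E.q=3|T_M0` -/

/-- **Rows `EK.E.q|T_M0` for real `q > 2` (kernel), on `T³`.** There is `κ > 0` such that
along every zero-mean classical solution of unforced Navier–Stokes on `T³ × [a, b]` with
`Z_q(u t) > 0` on the window, `t ↦ K(u t) − ((2q−3)/κ) ν^{(3q−3)/(2q−3)+1} Z_q(u t)^{−1/(2q−3)}` is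
antitone — `vorticityMoment_saturatingLaw` (κ raised to `max κ 1`) and
`SaturatingLaw.antitoneOn_lyapunov`. [folklore] -/
theorem vorticityMoment_lyapunov_antitoneOn {q : ℝ} (hq : 2 < q) :
    ∃ κ : ℝ, 0 < κ ∧ ∀ {ν a b : ℝ}, 0 < ν → a < b →
      ∀ {u : ℝ → UnitAddTorus (Fin 3) → EuclideanSpace ℝ (Fin 3)}
        {p : ℝ → UnitAddTorus (Fin 3) → ℝ},
        Torus.IsClassicalNSSolutionOn (Icc a b) ν 0 u p →
        (∀ t ∈ Icc a b, Torus.HasZeroMean (u t)) →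
        (∀ t ∈ Icc a b, 0 < torusVorticityMoment q (u t)) →
        AntitoneOn (fun t => Torus.kineticEnergy (u t) -
            (2 * q - 3) / κ * ν ^ ((3 * q - 3) / (2 * q - 3) + 1) *
              torusVorticityMoment q (u t) ^ (-(2 * q - 3)⁻¹)) (Icc a b) := by
  obtain ⟨κ₀, hκ₀⟩ := vorticityMoment_saturatingLaw hq
  have hF0 : ∀ v : UnitAddTorus (Fin 3) → EuclideanSpace ℝ (Fin 3), 0 ≤ torusVorticityMoment q v :=
    fun v => torusVorticityMoment_nonneg q v
  have hlaw := hκ₀.mono_kappa hF0 (le_max_left κ₀ 1)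
  have hκ : 0 < max κ₀ 1 := lt_of_lt_of_le one_pos (le_max_right _ _)
  refine ⟨max κ₀ 1, hκ, fun hν hab u p hsol hmean hpos => ?_⟩
  exact hlaw.antitoneOn_lyapunov (by linarith) hκ (by simp) hν hab hsol hmean hpos

/-- **Row `EK.E.q=5/2|T_M0` (kernel):** `∃ κ > 0`, `K − (2/κ) ν^{13/4} Z_{5/2}^{−1/2}` antitone on
positive-`Z_{5/2}` windows of zero-mean classical solutions on `T³`. [ours] -/
theorem vorticityMoment_lyapunov_five_halves :
    ∃ κ : ℝ, 0 < κ ∧ ∀ {ν a b : ℝ}, 0 < ν → a < b →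
      ∀ {u : ℝ → UnitAddTorus (Fin 3) → EuclideanSpace ℝ (Fin 3)}
        {p : ℝ → UnitAddTorus (Fin 3) → ℝ},
        Torus.IsClassicalNSSolutionOn (Icc a b) ν 0 u p →
        (∀ t ∈ Icc a b, Torus.HasZeroMean (u t)) →
        (∀ t ∈ Icc a b, 0 < torusVorticityMoment (5 / 2) (u t)) →
        AntitoneOn (fun t => Torus.kineticEnergy (u t) -
            2 / κ * ν ^ (13 / 4 : ℝ) * torusVorticityMoment (5 / 2) (u t) ^ (-(1 / 2 : ℝ)))
          (Icc a b) := by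
  obtain ⟨κ, hκ, h⟩ := vorticityMoment_lyapunov_antitoneOn (q := 5 / 2) (by norm_num)
  refine ⟨κ, hκ, fun hν hab u p hsol hmean hpos => ?_⟩
  have h' := h hν hab hsol hmean hpos
  refine h'.congr fun t _ => ?_
  norm_num

/-- **Row `EK.E.q=3|T_M0` (kernel):** `∃ κ > 0`, `K − (3/κ) ν³ Z₃^{−1/3}` antitone on positive-`Z₃`
windows of zero-mean classical solutions on `T³`. [ours] -/
theorem vorticityMoment_lyapunov_three :
    ∃ κ : ℝ, 0 < κ ∧ ∀ {ν a b : ℝ}, 0 < ν → a < b →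
      ∀ {u : ℝ → UnitAddTorus (Fin 3) → EuclideanSpace ℝ (Fin 3)}
        {p : ℝ → UnitAddTorus (Fin 3) → ℝ},
        Torus.IsClassicalNSSolutionOn (Icc a b) ν 0 u p →
        (∀ t ∈ Icc a b, Torus.HasZeroMean (u t)) →
        (∀ t ∈ Icc a b, 0 < torusVorticityMoment 3 (u t)) →
        AntitoneOn (fun t => Torus.kineticEnergy (u t) -
            3 / κ * ν ^ (3 : ℝ) * torusVorticityMoment 3 (u t) ^ (-(1 / 3 : ℝ))) (Icc a b) := by
  obtain ⟨κ, hκ, h⟩ := vorticityMoment_lyapunov_antitoneOn (q := 3) (by norm_num)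
  refine ⟨κ, hκ, fun hν hab u p hsol hmean hpos => ?_⟩
  have h' := h hν hab hsol hmean hpos
  refine h'.congr fun t _ => ?_
  norm_num

end VorticityMoment

end Summit.NavierStokesRegularity.FunctionalMining
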